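import Literature.Geometry.Riemannian.RicciDeTurckCoord
import Mathlib.Analysis.Calculus.MeanValue
import HarnessLib

/-!
# Lipschitz dependence of the lower-order part of the Ricci–DeTurck operator on the data
(topic `Geometry/Riemannian`)

Eighth layer of the DeTurck decomposition of the named fact
`Literature.Geometry.Riemannian.ricciFlow_uniqueness` (`RicciFlow.lean`; Hamilton 1982,
Thm. 5.1; Topping 2006, Thm. 5.2.2), towards uniqueness of the Ricci–DeTurck flow
(Andrews–Hopper 2011, §5.4.2, Step 1). In the coordinate form of the Ricci–DeTurck operator
(`RicciDeTurckCoord.rdt_rhs_eq_coord`: `-2 Ric + ℒ_W g = gʲⁱ ∂ᵢ∂ⱼ G + F`, with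
`F = rdtLower b (G x) g⁻¹ (DG x) (Γ̃ x) (∂Γ̃ x)` an explicit polynomial in the first-order data)
the difference of the lower-order terms of two solutions is controlled by the difference of
their data: this is the input `|fterm| ≤ K ‖H‖ (‖H‖ + ∑ ‖∂ₚH‖)` of the maximum-point estimate
`JetEstimate.two_mul_ip_le` (`RicciDeTurckJetEstimate.lean`), together with the Lipschitz
dependence `|g₁⁻¹ - g₂⁻¹| ≤ K ‖g₁ - g₂‖` of the inverse Gram matrix. This file PROVES both, with
constants uniform on bounded data. Everything is proved; no named fact and no `sorry`.

## Contents (all proved)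

* `Cfun`, `DCfun` (`Cfun_basis`, `DCfun_basis`) — background Christoffel data as points of the
  vector spaces `ι → ι → E`, `ι → ι → ι → E` (multilinear extension of the arrays of values on
  basis vectors); `rdtLower_congr_background` — on basis vectors `rdtLower` depends on the
  background only through those values.
* `Dat`, `rdtLowerModel` — the lower-order term as a function on the finite-dimensional data
  space `(A, Gi, D, Cv, DCv)`; **`contDiff_rdtLowerModel`** — it is `C¹` (a polynomial; Mathlib's
  `fun_prop`); **`exists_lipschitz_rdtLowerModel`**, **`exists_lipschitz_rdtLower`** — uniform
  Lipschitz bounds on balls (mean value inequality on the convex ball, derivative bounded on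
  the compact ball), in the form `|F₁ - F₂| ≤ L (‖A₁ - A₂‖ + ‖Gi₁ - Gi₂‖ + ‖D₁ - D₂‖)` for data
  sharing the background.
* **`abs_gramInv_sub_gramInv_le`** — `|(A₁⁻¹ - A₂⁻¹)ⱼᵢ| ≤ (∑ |A₁⁻¹| |A₂⁻¹| ‖b‖ ‖b‖) ‖A₁ - A₂‖`
  (Mathlib's `Matrix.inv_sub_inv`).
* `opNorm_le_sum_basis` (`‖L‖ ≤ ∑ ‖bᵖ‖ ‖L bₚ‖`), `bilinOfCoeffs` (a form with prescribed
  components, `bilinOfCoeffs_basis`) and `norm_bilinOfCoeffs_le`.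

## References

* B. Andrews, C. Hopper, *The Ricci flow in Riemannian geometry*, LNM 2011, Springer 2011,
  §5.4.1, (5.6)–(5.9); §5.4.2, Step 1. [AndrewsHopper2011]
-/

noncomputable section

set_option maxSynthPendingDepth 3

open Set Function Filter ContinuousLinearMap TopologicalSpace Metric
open scoped Topology

namespace Literature.Geometry.Riemannian

namespace OpensChart

variable {E : Type*} [NormedAddCommGroup E] [NormedSpace ℝ E]
  {ι : Type*} [Fintype ι] [DecidableEq ι] (b : Module.Basis ι ℝ E)

/-! ### Background Christoffel data through arrays of vectors -/

/-- The bilinear extension of an array of vectors: `Cfun b Cv v w = ∑ᵢⱼ vⁱ wʲ Cv i j`, a map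
`E → E → E` with `Cfun b Cv (bᵢ) (bⱼ) = Cv i j` (`Cfun_basis`). Through it the background
Christoffel vectors `Γ̃(bᵢ, bⱼ)` enter the lower-order term `rdtLower` as a point of the vector
space `ι → ι → E`. [folklore] -/
def Cfun (Cv : ι → ι → E) : E → E → E := fun v w ↦ ∑ i, ∑ j, (b.coord i v * b.coord j w) • Cv i j

/-- The trilinear extension of an array of vectors (the derivatives `∂ₚ Γ̃(bᵢ, bⱼ)` of the
background Christoffel vectors): `DCfun b DCv V v w = ∑ₚ Vᵖ Cfun b (DCv p) v w`. [folklore] -/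
def DCfun (DCv : ι → ι → ι → E) : E → E → E → E := fun V v w ↦ ∑ p, b.coord p V • Cfun b (DCv p) v w

omit [DecidableEq ι] in
/-- `Cfun` on basis vectors returns the array. [folklore] -/
@[simp]
theorem Cfun_basis (Cv : ι → ι → E) (i j : ι) : Cfun b Cv (b i) (b j) = Cv i j := by
  classical
  simp only [Cfun, Module.Basis.coord_apply, Module.Basis.repr_self, Finsupp.single_apply]
  rw [Finset.sum_eq_single i (fun k _ hk ↦ by simp [Ne.symm hk]) (by simp)]
  rw [Finset.sum_eq_single j (fun k _ hk ↦ by simp [Ne.symm hk]) (by simp)]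
  simp

omit [DecidableEq ι] in
/-- `DCfun` on basis vectors returns the array. [folklore] -/
@[simp]
theorem DCfun_basis (DCv : ι → ι → ι → E) (p i j : ι) :
    DCfun b DCv (b p) (b i) (b j) = DCv p i j := by
  classical
  simp only [DCfun, Cfun_basis, Module.Basis.coord_apply, Module.Basis.repr_self,
    Finsupp.single_apply]
  rw [Finset.sum_eq_single p (fun k _ hk ↦ by simp [Ne.symm hk]) (by simp)]
  simp

omit [DecidableEq ι] in
/-- **`rdtLower` on basis vectors depends on the background only through its values on basis
vectors.** [folklore] -/
theorem rdtLower_congr_background (A : E →L[ℝ] E →L[ℝ] ℝ) (Gi : Matrix ι ι ℝ)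
    (D : E →L[ℝ] E →L[ℝ] E →L[ℝ] ℝ) {C C' : E → E → E} {DC DC' : E → E → E → E}
    (hC : ∀ i j, C (b i) (b j) = C' (b i) (b j))
    (hDC : ∀ p i j, DC (b p) (b i) (b j) = DC' (b p) (b i) (b j)) (c i : ι) :
    rdtLower b A Gi D C DC (b c) (b i) = rdtLower b A Gi D C' DC' (b c) (b i) := by
  simp only [rdtLower, lieLowerHalf, wflat, hC, hDC]

/-! ### The lower-order term as a smooth function of the data -/

variable (E ι) in
/-- The data space of the lower-order term at a point: metric components `A`, inverse Gram
entries `Gi` (as an array), first derivative `D`, background arrays `Cv`, `DCv`. [folklore] -/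
abbrev Dat : Type _ :=
  (E →L[ℝ] E →L[ℝ] ℝ) × (ι → ι → ℝ) × (E →L[ℝ] E →L[ℝ] E →L[ℝ] ℝ) × (ι → ι → E) × (ι → ι → ι → E)

/-- **The lower-order term of the Ricci–DeTurck operator as a function on the data space**,
evaluated on the basis pair `(b_c, bᵢ)`: `rdtLowerModel b c i d =
rdtLower b A Gi D (Cfun Cv) (DCfun DCv) (b c) (bᵢ)` for `d = (A, Gi, D, Cv, DCv)`. [folklore] -/
def rdtLowerModel (c i : ι) (d : Dat E ι) : ℝ :=
  rdtLower b d.1 (d.2.1 : Matrix ι ι ℝ) d.2.2.1 (Cfun b d.2.2.2.1) (DCfun b d.2.2.2.2) (b c) (b i)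

omit [DecidableEq ι] in
/-- **The lower-order term is a smooth (polynomial) function of the data** (it is built from
evaluations of multilinear maps, entries, finite sums and products; Mathlib's `fun_prop`).
[folklore] -/
theorem contDiff_rdtLowerModel (c i : ι) :
    ContDiff ℝ 1 (rdtLowerModel b c i : Dat E ι → ℝ) := by
  unfold rdtLowerModel rdtLower ricLower lieLowerHalf wflat chris dGramInv kos DCfun Cfun
  simp only [Matrix.of_apply]
  fun_prop

variable [FiniteDimensional ℝ E]

omit [DecidableEq ι] in
/-- **Uniform Lipschitz bound for the lower-order term on bounded data.** For every radius `R`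
there is `L ≥ 0` with `|rdtLowerModel d₁ - rdtLowerModel d₂| ≤ L ‖d₁ - d₂‖` for all data
`d₁, d₂` in the closed ball of radius `R` (mean value inequality on the convex ball, with the
derivative of the smooth model bounded on the compact ball; `E` finite-dimensional).
[folklore] -/
theorem exists_lipschitz_rdtLowerModel (c i : ι) (R : ℝ) :
    ∃ L : ℝ, 0 ≤ L ∧ ∀ d₁ ∈ closedBall (0 : Dat E ι) R, ∀ d₂ ∈ closedBall (0 : Dat E ι) R,
      |rdtLowerModel b c i d₁ - rdtLowerModel b c i d₂| ≤ L * ‖d₁ - d₂‖ := by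
  have hf : ContDiff ℝ 1 (rdtLowerModel b c i : Dat E ι → ℝ) := contDiff_rdtLowerModel b c i
  have hcont : Continuous (fderiv ℝ (rdtLowerModel b c i : Dat E ι → ℝ)) :=
    hf.continuous_fderiv one_ne_zero
  haveI : ProperSpace (Dat E ι) := FiniteDimensional.proper ℝ (Dat E ι)
  obtain ⟨C, hC⟩ := (isCompact_closedBall (0 : Dat E ι) R).exists_bound_of_continuousOn
    (f := fderiv ℝ (rdtLowerModel b c i)) (hcont.continuousOn (s := closedBall (0 : Dat E ι) R))
  refine ⟨max C 0, le_max_right _ _, fun d₁ hd₁ d₂ hd₂ ↦ ?_⟩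
  have h := (convex_closedBall (0 : Dat E ι) R).norm_image_sub_le_of_norm_fderiv_le
    (f := rdtLowerModel b c i) (C := max C 0) (fun d _ ↦ (hf.differentiable one_ne_zero) d)
    (fun d hd ↦ (hC d hd).trans (le_max_left C 0)) hd₂ hd₁
  rw [Real.norm_eq_abs] at h
  exact h

omit [DecidableEq ι] in
/-- **Uniform Lipschitz bound for the lower-order term, all components, common background.**
For every radius `R` there is `L ≥ 0` such that for all basis pairs `(b_c, bᵢ)`, all data of
norm `≤ R` sharing the background arrays,
`|F(A₁, Gi₁, D₁)(b_c, bᵢ) - F(A₂, Gi₂, D₂)(b_c, bᵢ)| ≤ L (‖A₁ - A₂‖ + ‖Gi₁ - Gi₂‖ + ‖D₁ - D₂‖)`,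
`F = rdtLower b · · · (Cfun b Cv) (DCfun b DCv)` — the form in which the first-order remainder of
the difference of two Ricci–DeTurck flows is controlled by `|g₁ - g₂|` and `|∂(g₁ - g₂)|`.
[folklore] -/
theorem exists_lipschitz_rdtLower (R : ℝ) :
    ∃ L : ℝ, 0 ≤ L ∧ ∀ (c i : ι) (A₁ A₂ : E →L[ℝ] E →L[ℝ] ℝ) (G₁ G₂ : ι → ι → ℝ)
      (D₁ D₂ : E →L[ℝ] E →L[ℝ] E →L[ℝ] ℝ) (Cv : ι → ι → E) (DCv : ι → ι → ι → E),
      ‖((A₁, G₁, D₁, Cv, DCv) : Dat E ι)‖ ≤ R → ‖((A₂, G₂, D₂, Cv, DCv) : Dat E ι)‖ ≤ R →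
      |rdtLower b A₁ (G₁ : Matrix ι ι ℝ) D₁ (Cfun b Cv) (DCfun b DCv) (b c) (b i)
        - rdtLower b A₂ (G₂ : Matrix ι ι ℝ) D₂ (Cfun b Cv) (DCfun b DCv) (b c) (b i)| ≤
        L * (‖A₁ - A₂‖ + ‖G₁ - G₂‖ + ‖D₁ - D₂‖) := by
  choose L hL0 hL using fun p : ι × ι ↦ exists_lipschitz_rdtLowerModel b p.1 p.2 R
  refine ⟨∑ p, L p, Finset.sum_nonneg fun p _ ↦ hL0 p, fun c i A₁ A₂ G₁ G₂ D₁ D₂ Cv DCv h₁ h₂ ↦ ?_⟩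
  have hmem₁ : ((A₁, G₁, D₁, Cv, DCv) : Dat E ι) ∈ closedBall (0 : Dat E ι) R := by
    simpa using h₁
  have hmem₂ : ((A₂, G₂, D₂, Cv, DCv) : Dat E ι) ∈ closedBall (0 : Dat E ι) R := by
    simpa using h₂
  have h := hL (c, i) _ hmem₁ _ hmem₂
  simp only [rdtLowerModel] at h
  have hnorm : ‖((A₁, G₁, D₁, Cv, DCv) : Dat E ι) - (A₂, G₂, D₂, Cv, DCv)‖ ≤
      ‖A₁ - A₂‖ + ‖G₁ - G₂‖ + ‖D₁ - D₂‖ := by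
    simp only [Prod.mk_sub_mk, sub_self, Prod.norm_def, norm_zero]
    have h1 := norm_nonneg (A₁ - A₂)
    have h2 := norm_nonneg (G₁ - G₂)
    have h3 := norm_nonneg (D₁ - D₂)
    refine max_le (by linarith) (max_le (by linarith) (max_le (by linarith) (by linarith)))
  have hLle : L (c, i) ≤ ∑ p, L p :=
    Finset.single_le_sum (fun p _ ↦ hL0 p) (Finset.mem_univ (c, i))
  calc |rdtLower b A₁ (G₁ : Matrix ι ι ℝ) D₁ (Cfun b Cv) (DCfun b DCv) (b c) (b i)
        - rdtLower b A₂ (G₂ : Matrix ι ι ℝ) D₂ (Cfun b Cv) (DCfun b DCv) (b c) (b i)|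
      ≤ L (c, i) * ‖((A₁, G₁, D₁, Cv, DCv) : Dat E ι) - (A₂, G₂, D₂, Cv, DCv)‖ := h
    _ ≤ (∑ p, L p) * (‖A₁ - A₂‖ + ‖G₁ - G₂‖ + ‖D₁ - D₂‖) :=
        mul_le_mul hLle hnorm (norm_nonneg _) (Finset.sum_nonneg fun p _ ↦ hL0 p)

/-! ### Lipschitz dependence of the inverse Gram matrix on the metric -/

omit [FiniteDimensional ℝ E] in
/-- **The inverse Gram matrix is Lipschitz in the metric components**:
`|(A₁⁻¹ - A₂⁻¹)ⱼᵢ| ≤ (∑ₐ_c |A₁⁻¹ⱼₐ| |A₂⁻¹_cᵢ| ‖bₐ‖ ‖b_c‖) ‖A₁ - A₂‖` for nondegenerate `A₁, A₂`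
(`A₁⁻¹ - A₂⁻¹ = A₁⁻¹ (A₂ - A₁) A₂⁻¹`, Mathlib's `Matrix.inv_sub_inv`). [folklore] -/
theorem abs_gramInv_sub_gramInv_le (A₁ A₂ : E →L[ℝ] E →L[ℝ] ℝ)
    (h₁ : (Matrix.of fun i j ↦ A₁ (b i) (b j)).det ≠ 0)
    (h₂ : (Matrix.of fun i j ↦ A₂ (b i) (b j)).det ≠ 0) (j i : ι) :
    |gramInv b A₁ j i - gramInv b A₂ j i| ≤
      (∑ a, ∑ c, |gramInv b A₁ j a| * |gramInv b A₂ c i| * ‖b a‖ * ‖b c‖) * ‖A₁ - A₂‖ := by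
  set M₁ : Matrix ι ι ℝ := Matrix.of fun i j ↦ A₁ (b i) (b j) with hM₁
  set M₂ : Matrix ι ι ℝ := Matrix.of fun i j ↦ A₂ (b i) (b j) with hM₂
  have hu : IsUnit M₁ ↔ IsUnit M₂ := by
    rw [Matrix.isUnit_iff_isUnit_det, Matrix.isUnit_iff_isUnit_det]
    exact ⟨fun _ ↦ Ne.isUnit h₂, fun _ ↦ Ne.isUnit h₁⟩
  have hsub : gramInv b A₁ - gramInv b A₂ = M₁⁻¹ * (M₂ - M₁) * M₂⁻¹ := Matrix.inv_sub_inv hu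
  have hentry : gramInv b A₁ j i - gramInv b A₂ j i =
      ∑ c, (∑ a, gramInv b A₁ j a * (M₂ - M₁) a c) * gramInv b A₂ c i := by
    have h := congrFun (congrFun hsub j) i
    rw [Matrix.sub_apply] at h
    rw [h, Matrix.mul_apply]
    refine Finset.sum_congr rfl fun c _ ↦ ?_
    rw [Matrix.mul_apply]
    rfl
  have hM : ∀ a c, |(M₂ - M₁) a c| ≤ ‖A₁ - A₂‖ * ‖b a‖ * ‖b c‖ := by
    intro a c
    rw [Matrix.sub_apply, hM₁, hM₂, Matrix.of_apply, Matrix.of_apply, ← Real.norm_eq_abs,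
      ← norm_neg, neg_sub, show A₁ (b a) (b c) - A₂ (b a) (b c) = (A₁ - A₂) (b a) (b c) by
        simp only [_root_.sub_apply]]
    exact ((A₁ - A₂) (b a)).le_of_opNorm_le ((A₁ - A₂).le_opNorm (b a)) (b c)
  rw [hentry]
  calc |∑ c, (∑ a, gramInv b A₁ j a * (M₂ - M₁) a c) * gramInv b A₂ c i|
      ≤ ∑ c, |(∑ a, gramInv b A₁ j a * (M₂ - M₁) a c) * gramInv b A₂ c i| :=
        Finset.abs_sum_le_sum_abs _ _
    _ ≤ ∑ c, ∑ a, |gramInv b A₁ j a| * |(M₂ - M₁) a c| * |gramInv b A₂ c i| :=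
        Finset.sum_le_sum fun c _ ↦ by
          rw [Finset.sum_mul]
          refine (Finset.abs_sum_le_sum_abs _ _).trans_eq ?_
          exact Finset.sum_congr rfl fun a _ ↦ by rw [abs_mul, abs_mul]
    _ ≤ ∑ c, ∑ a, |gramInv b A₁ j a| * (‖A₁ - A₂‖ * ‖b a‖ * ‖b c‖) * |gramInv b A₂ c i| := by
        gcongr with c _ a _
        exact hM a c
    _ = (∑ a, ∑ c, |gramInv b A₁ j a| * |gramInv b A₂ c i| * ‖b a‖ * ‖b c‖) * ‖A₁ - A₂‖ := by
        rw [Finset.sum_comm, Finset.sum_mul]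
        refine Finset.sum_congr rfl fun a _ ↦ ?_
        rw [Finset.sum_mul]
        exact Finset.sum_congr rfl fun c _ ↦ by ring

/-! ### Norm comparisons in the basis -/

omit [DecidableEq ι] in
/-- **The operator norm is controlled by the values on a basis**:
`‖L‖ ≤ ∑ₚ ‖bᵖ‖ ‖L(bₚ)‖` with `bᵖ` the coordinate functionals (`L v = ∑ₚ bᵖ(v) L(bₚ)`). [folklore] -/
theorem opNorm_le_sum_basis {F : Type*} [NormedAddCommGroup F] [NormedSpace ℝ F] (L : E →L[ℝ] F) :
    ‖L‖ ≤ ∑ p, ‖(b.coord p).toContinuousLinearMap‖ * ‖L (b p)‖ := by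
  refine ContinuousLinearMap.opNorm_le_bound _ (Finset.sum_nonneg fun p _ ↦ by positivity)
    fun v ↦ ?_
  have hv : L v = ∑ p, b.coord p v • L (b p) := by
    conv_lhs => rw [← b.sum_repr v]
    simp only [map_sum, map_smul, Module.Basis.coord_apply]
  rw [hv, Finset.sum_mul]
  refine (norm_sum_le _ _).trans (Finset.sum_le_sum fun p _ ↦ ?_)
  rw [norm_smul]
  have h1 : ‖b.coord p v‖ ≤ ‖(b.coord p).toContinuousLinearMap‖ * ‖v‖ :=
    (b.coord p).toContinuousLinearMap.le_opNorm v
  calc ‖b.coord p v‖ * ‖L (b p)‖ ≤ ‖(b.coord p).toContinuousLinearMap‖ * ‖v‖ * ‖L (b p)‖ := by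
        gcongr
    _ = ‖(b.coord p).toContinuousLinearMap‖ * ‖L (b p)‖ * ‖v‖ := by ring

/-- **A bilinear form with prescribed components in the basis**:
`bilinOfCoeffs b f = ∑_{c,i} f c i • bᶜ ⊗ bⁱ`, with `bilinOfCoeffs b f (b_c) (bᵢ) = f c i`.
[folklore] -/
def bilinOfCoeffs (f : ι → ι → ℝ) : E →L[ℝ] E →L[ℝ] ℝ :=
  ∑ c, ∑ i, f c i • ((ContinuousLinearMap.mul ℝ ℝ).comp
    (b.coord c).toContinuousLinearMap).flip.comp (b.coord i).toContinuousLinearMap |>.flip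

omit [DecidableEq ι] in
/-- Evaluation of `bilinOfCoeffs`: `bilinOfCoeffs b f v w = ∑ f c i bᶜ(v) bⁱ(w)`. [folklore] -/
theorem bilinOfCoeffs_apply (f : ι → ι → ℝ) (v w : E) :
    bilinOfCoeffs b f v w = ∑ c, ∑ i, f c i * (b.coord c v * b.coord i w) := by
  simp only [bilinOfCoeffs, FunLike.coe_sum, Finset.sum_apply, FunLike.coe_smul, Pi.smul_apply,
    ContinuousLinearMap.flip_apply, ContinuousLinearMap.coe_comp, Function.comp_apply,
    LinearMap.coe_toContinuousLinearMap', ContinuousLinearMap.mul_apply', smul_eq_mul]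

omit [DecidableEq ι] in
/-- `bilinOfCoeffs` has the prescribed components. [folklore] -/
@[simp]
theorem bilinOfCoeffs_basis (f : ι → ι → ℝ) (c i : ι) : bilinOfCoeffs b f (b c) (b i) = f c i := by
  classical
  rw [bilinOfCoeffs_apply]
  simp only [Module.Basis.coord_apply, Module.Basis.repr_self, Finsupp.single_apply]
  rw [Finset.sum_eq_single c (fun k _ hk ↦ by simp [Ne.symm hk]) (by simp)]
  rw [Finset.sum_eq_single i (fun k _ hk ↦ by simp [Ne.symm hk]) (by simp)]
  simp

omit [DecidableEq ι] in
/-- Norm bound for `bilinOfCoeffs`: `‖bilinOfCoeffs b f‖ ≤ ∑ |f c i| ‖bᶜ‖ ‖bⁱ‖`. [folklore] -/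
theorem norm_bilinOfCoeffs_le (f : ι → ι → ℝ) :
    ‖bilinOfCoeffs b f‖ ≤ ∑ c, ∑ i, |f c i| * ‖(b.coord c).toContinuousLinearMap‖ *
      ‖(b.coord i).toContinuousLinearMap‖ := by
  refine ContinuousLinearMap.opNorm_le_bound _ (Finset.sum_nonneg fun _ _ ↦
    Finset.sum_nonneg fun _ _ ↦ by positivity) fun v ↦ ?_
  refine ContinuousLinearMap.opNorm_le_bound _ (by positivity) fun w ↦ ?_
  rw [bilinOfCoeffs_apply, Finset.sum_mul, Finset.sum_mul]
  refine (norm_sum_le _ _).trans (Finset.sum_le_sum fun c _ ↦ ?_)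
  rw [Finset.sum_mul, Finset.sum_mul]
  refine (norm_sum_le _ _).trans (Finset.sum_le_sum fun i _ ↦ ?_)
  rw [norm_mul, norm_mul, Real.norm_eq_abs]
  have hc : ‖b.coord c v‖ ≤ ‖(b.coord c).toContinuousLinearMap‖ * ‖v‖ :=
    (b.coord c).toContinuousLinearMap.le_opNorm v
  have hi : ‖b.coord i w‖ ≤ ‖(b.coord i).toContinuousLinearMap‖ * ‖w‖ :=
    (b.coord i).toContinuousLinearMap.le_opNorm w
  calc |f c i| * (‖b.coord c v‖ * ‖b.coord i w‖)
      ≤ |f c i| * ((‖(b.coord c).toContinuousLinearMap‖ * ‖v‖) *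
          (‖(b.coord i).toContinuousLinearMap‖ * ‖w‖)) := by gcongr
    _ = |f c i| * ‖(b.coord c).toContinuousLinearMap‖ * ‖(b.coord i).toContinuousLinearMap‖
          * ‖v‖ * ‖w‖ := by ring

end OpensChart

end Literature.Geometry.Riemannian

end
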